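import Mathlib

/-!
# Noncritical Belyi maps on `ℙ¹`, step IV-a: the fractional linear change of variable in the
# `(p, q) ∈ ℚ[x]²` format

Both printed constructions of a Belyi map on `ℙ¹` noncritical at a prescribed point `α`
(Mochizuki [NCBelyi] Lemma 2.3 + Thm. 2.5; Scherr–Zieve [cite: ScherrZieve2014] Lemma 6 + proof of
Thm. 1) begin by "applying an appropriate fractional linear transformation with rational
coefficients" that moves `α` to a convenient point.  In the tree a rational function on `ℙ¹_ℚ` is a
pair of polynomials `(p, q)` (cf. `BelyiLemma.lean`), so composing `F ∈ ℚ[x]` of degree `≤ d` with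
the Möbius map `μ(x) = b·x/(x + c)` is the HOMOGENISED SUBSTITUTION

  `H_d(F) := Σ_{j ≤ d} F_j b^j · x^j (x + c)^{d − j} = (x + c)^d · F(μ(x))`.

This file provides the bookkeeping the assembly (`NoncriticalBelyiGenusZero.lean`) needs, for
`F, P, Q ∈ ℚ[x]` of degree `≤ d`:
* `homSubst_natDegree_le`, `homSubst_coeff_top` (`= F(b)`), `homSubst_coeff_pred`
  (`= c·(d·F(b) − b·F'(b))`) — value and ramification of the composite at `x = ∞ ↦ μ(∞) = b`;
* `aeval_homSubst` (`= (z + c)^d F(μ z)` for `z ≠ −c`), `aeval_homSubst_neg` (value at the pole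
  `z = −c ↦ μ(−c) = ∞`: `F_d · (−bc)^d`);
* `wronskian_homSubst_eq_zero`: at a point `z ≠ −c` where `H_d(Q) ≠ 0`, if the Wronskian of
  `(H_d P, H_d Q)` vanishes then the Wronskian of `(P, Q)` vanishes at `μ(z)` — the chain rule for
  `(P/Q) ∘ μ`, proved with complex derivatives (`HasDerivAt`).
No definitions (the substitution is written out as a `Finset` sum), no named facts.
-/

namespace Literature.NumberTheory.DiophantineGeometry

open Polynomial Finset

namespace NoncriticalBelyi

variable (F : ℚ[X]) (d : ℕ) (b c : ℚ)

/-- `deg H_d(F) ≤ d`.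
[cite: ScherrZieve2014, Thm 1 (proof, fractional linear change of variable)] -/
theorem homSubst_natDegree_le :
    (∑ j ∈ range (d + 1), C (F.coeff j * b ^ j) * X ^ j * (X + C c) ^ (d - j)).natDegree ≤ d := by
  refine natDegree_sum_le_of_forall_le _ _ fun j hj => ?_
  rw [mem_range] at hj
  calc (C (F.coeff j * b ^ j) * X ^ j * (X + C c) ^ (d - j)).natDegree
      ≤ (C (F.coeff j * b ^ j) * X ^ j).natDegree + ((X + C c) ^ (d - j)).natDegree :=
        natDegree_mul_le
    _ ≤ j + (d - j) := by
        gcongr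
        · exact (natDegree_C_mul_le _ _).trans (natDegree_X_pow j).le
        · exact (natDegree_pow_le_of_le _ (natDegree_X_add_C c).le).trans (by rw [mul_one])
    _ = d := by omega

/-- The top coefficient of `H_d(F)` is `F(b)` (the value of `F ∘ μ` at `x = ∞`), when `deg F ≤ d`.
[cite: ScherrZieve2014, Thm 1 (proof, fractional linear change of variable)] -/
theorem homSubst_coeff_top (hF : F.natDegree ≤ d) :
    (∑ j ∈ range (d + 1), C (F.coeff j * b ^ j) * X ^ j * (X + C c) ^ (d - j)).coeff d =
      F.eval b := by
  rw [finsetSum_coeff, eval_eq_sum_range' (Nat.lt_succ_of_le hF)]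
  refine sum_congr rfl fun j hj => ?_
  rw [mem_range] at hj
  rw [mul_assoc, coeff_C_mul, coeff_X_pow_mul', if_pos (by omega), coeff_X_add_C_pow,
    Nat.sub_self, pow_zero, Nat.choose_self, Nat.cast_one, mul_one, mul_one]

/-- The next coefficient of `H_d(F)`: `c·(d·F(b) − b·F'(b))` (it governs the ramification of the
composite at `∞`), when `deg F ≤ d`.
[cite: ScherrZieve2014, Thm 1 (proof, fractional linear change of variable)] -/
theorem homSubst_coeff_pred (hF : F.natDegree ≤ d) (hd : 1 ≤ d) :
    (∑ j ∈ range (d + 1), C (F.coeff j * b ^ j) * X ^ j * (X + C c) ^ (d - j)).coeff (d - 1) =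
      c * (d * F.eval b - b * (derivative F).eval b) := by
  rw [finsetSum_coeff]
  have hterm : ∀ j ∈ range (d + 1),
      (C (F.coeff j * b ^ j) * X ^ j * (X + C c) ^ (d - j)).coeff (d - 1) =
        c * (((d : ℚ) - j) * (F.coeff j * b ^ j)) := by
    intro j hj
    rw [mem_range] at hj
    rw [mul_assoc, coeff_C_mul, coeff_X_pow_mul']
    rcases Nat.lt_or_ge j d with hjd | hjd
    · rw [if_pos (by omega), coeff_X_add_C_pow, show d - 1 - j = (d - j) - 1 by omega,
        show d - j - (d - j - 1) = 1 by omega, pow_one, Nat.choose_symm (by omega),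
        Nat.choose_one_right, Nat.cast_sub hjd.le]
      ring
    · have hj : j = d := by omega
      subst hj
      rw [if_neg (by omega)]; simp
  rw [sum_congr rfl hterm, ← mul_sum, eval_eq_sum_range' (Nat.lt_succ_of_le hF),
    derivative_eval, sum_over_range' _ (fun n => by simp) (d + 1) (Nat.lt_succ_of_le hF)]
  congr 1
  rw [mul_sum, mul_sum, ← sum_sub_distrib]
  refine sum_congr rfl fun j _ => ?_
  rcases Nat.eq_zero_or_pos j with rfl | hj0
  · simp
  · obtain ⟨k, rfl⟩ : ∃ k, j = k + 1 := ⟨j - 1, by omega⟩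
    simp only [Nat.add_sub_cancel, pow_succ, Nat.cast_add, Nat.cast_one]
    ring

/-- Evaluation away from the pole: `H_d(F)(z) = (z + c)^d · F(b z/(z + c))` for `z ≠ −c` (in any
field over `ℚ`). [cite: ScherrZieve2014, Thm 1 (proof, fractional linear change of variable)] -/
theorem aeval_homSubst {A : Type*} [Field A] [Algebra ℚ A] (hF : F.natDegree ≤ d) (z : A)
    (hz : z + algebraMap ℚ A c ≠ 0) :
    aeval z (∑ j ∈ range (d + 1), C (F.coeff j * b ^ j) * X ^ j * (X + C c) ^ (d - j)) =
      (z + algebraMap ℚ A c) ^ d * aeval (algebraMap ℚ A b * z / (z + algebraMap ℚ A c)) F := by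
  rw [map_sum, aeval_eq_sum_range' (Nat.lt_succ_of_le hF), mul_sum]
  refine sum_congr rfl fun j hj => ?_
  rw [mem_range] at hj
  simp only [map_mul, map_pow, aeval_C, aeval_X, map_add, Algebra.smul_def]
  have hsplit : (z + algebraMap ℚ A c) ^ d =
      (z + algebraMap ℚ A c) ^ (d - j) * (z + algebraMap ℚ A c) ^ j := by
    rw [← pow_add, Nat.sub_add_cancel (by omega)]
  have hzj : (z + algebraMap ℚ A c) ^ j ≠ 0 := pow_ne_zero j hz
  rw [hsplit, div_pow, mul_pow]
  field_simp

/-- Value at the pole of `μ`: `H_d(F)(−c) = F_d · (−b c)^d` (the composite maps `−c ↦ F(∞)`).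
[cite: ScherrZieve2014, Thm 1 (proof, fractional linear change of variable)] -/
theorem aeval_homSubst_neg {A : Type*} [Field A] [Algebra ℚ A] :
    aeval (-algebraMap ℚ A c)
        (∑ j ∈ range (d + 1), C (F.coeff j * b ^ j) * X ^ j * (X + C c) ^ (d - j)) =
      algebraMap ℚ A (F.coeff d * (-(b * c)) ^ d) := by
  rw [map_sum, sum_range_succ, sum_eq_zero, zero_add]
  · simp only [map_mul, map_pow, aeval_C, aeval_X, Nat.sub_self, pow_zero, mul_one, map_neg]
    ring
  · intro j hj
    rw [mem_range] at hj
    simp only [map_mul, map_pow, aeval_C, aeval_X, map_add, neg_add_cancel,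
      zero_pow (Nat.sub_ne_zero_of_lt hj), mul_zero]

/-- The Möbius map `μ(x) = b x/(x + c)` has derivative `b c/(z + c)²` at `z ≠ −c`. [folklore] -/
private theorem hasDerivAt_moebius (b' c' z : ℂ) (hz : z + c' ≠ 0) :
    HasDerivAt (fun x : ℂ => b' * x / (x + c')) (b' * c' / (z + c') ^ 2) z := by
  have h1 : HasDerivAt (fun x : ℂ => b' * x) b' z := by
    simpa using (hasDerivAt_id' z).const_mul b'
  have h2 : HasDerivAt (fun x : ℂ => x + c') 1 z := (hasDerivAt_id' z).add_const c'
  have h := h1.div h2 hz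
  have heq : (b' * (z + c') - b' * z * 1) / (z + c') ^ 2 = b' * c' / (z + c') ^ 2 := by ring
  rw [heq] at h
  exact h

/-- **Chain rule at a finite non-polar point.** For `P, Q ∈ ℚ[x]` of degree `≤ d`, `b c ≠ 0`, and a
complex `z ≠ −c` with `H_d(Q)(z) ≠ 0`: if the Wronskian of `(H_d P, H_d Q)` vanishes at `z`, then
the Wronskian `P'Q − PQ'` vanishes at `μ(z) = b z/(z + c)` — i.e. critical points of `(P/Q) ∘ μ`
away from the pole are among the preimages of critical points of `P/Q`.
[cite: ScherrZieve2014, Thm 1 (proof, fractional linear change of variable)] -/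
theorem wronskian_homSubst_eq_zero (P Q : ℚ[X]) (hP : P.natDegree ≤ d) (hQ : Q.natDegree ≤ d)
    (hbc : b * c ≠ 0) (z : ℂ) (hz : z + algebraMap ℚ ℂ c ≠ 0)
    (hq : aeval z (∑ j ∈ range (d + 1), C (Q.coeff j * b ^ j) * X ^ j * (X + C c) ^ (d - j)) ≠ 0)
    (hW : aeval z
      (derivative (∑ j ∈ range (d + 1), C (P.coeff j * b ^ j) * X ^ j * (X + C c) ^ (d - j)) *
          (∑ j ∈ range (d + 1), C (Q.coeff j * b ^ j) * X ^ j * (X + C c) ^ (d - j)) -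
        (∑ j ∈ range (d + 1), C (P.coeff j * b ^ j) * X ^ j * (X + C c) ^ (d - j)) *
          derivative (∑ j ∈ range (d + 1), C (Q.coeff j * b ^ j) * X ^ j * (X + C c) ^ (d - j)))
      = 0) :
    aeval (algebraMap ℚ ℂ b * z / (z + algebraMap ℚ ℂ c)) (derivative P * Q - P * derivative Q)
      = 0 := by
  set HP : ℚ[X] := ∑ j ∈ range (d + 1), C (P.coeff j * b ^ j) * X ^ j * (X + C c) ^ (d - j)
    with hHP
  set HQ : ℚ[X] := ∑ j ∈ range (d + 1), C (Q.coeff j * b ^ j) * X ^ j * (X + C c) ^ (d - j)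
    with hHQ
  have hb'c' : algebraMap ℚ ℂ b * algebraMap ℚ ℂ c ≠ 0 := by
    rw [← map_mul, map_ne_zero_iff _ (algebraMap ℚ ℂ).injective]; exact hbc
  set y : ℂ := algebraMap ℚ ℂ b * z / (z + algebraMap ℚ ℂ c) with hy
  -- `Q(y) ≠ 0`
  have hQy : aeval y Q ≠ 0 := by
    intro h
    apply hq
    rw [hHQ, aeval_homSubst Q d b c hQ z hz, ← hy, h, mul_zero]
  -- derivative of `f = H(P)/H(Q)` at `z` is `0`
  have hf : HasDerivAt (fun x : ℂ => aeval x HP / aeval x HQ) 0 z := by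
    have h := (HP.hasDerivAt_aeval z).div (HQ.hasDerivAt_aeval z) hq
    have hnum :
        aeval z (derivative HP) * aeval z HQ - aeval z HP * aeval z (derivative HQ) = 0 := by
      rw [← hW, map_sub, map_mul, map_mul]
    rwa [hnum, zero_div] at h
  -- derivative of `g = (P/Q) ∘ μ` at `z`
  have hg : HasDerivAt ((fun u : ℂ => aeval u P / aeval u Q) ∘
        fun x : ℂ => algebraMap ℚ ℂ b * x / (x + algebraMap ℚ ℂ c))
      ((aeval y (derivative P) * aeval y Q - aeval y P * aeval y (derivative Q)) / (aeval y Q) ^ 2 *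
        (algebraMap ℚ ℂ b * algebraMap ℚ ℂ c / (z + algebraMap ℚ ℂ c) ^ 2)) z := by
    have hPQ : HasDerivAt (fun u : ℂ => aeval u P / aeval u Q)
        ((aeval y (derivative P) * aeval y Q - aeval y P * aeval y (derivative Q)) /
          (aeval y Q) ^ 2) (algebraMap ℚ ℂ b * z / (z + algebraMap ℚ ℂ c)) := by
      rw [← hy]; exact (P.hasDerivAt_aeval y).div (Q.hasDerivAt_aeval y) hQy
    exact hPQ.comp z (hasDerivAt_moebius _ _ z hz)
  -- `f = g` near `z`
  have hfg : (fun x : ℂ => aeval x HP / aeval x HQ) =ᶠ[nhds z]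
      ((fun u : ℂ => aeval u P / aeval u Q) ∘
        fun x : ℂ => algebraMap ℚ ℂ b * x / (x + algebraMap ℚ ℂ c)) := by
    have hopen : IsOpen {x : ℂ | x + algebraMap ℚ ℂ c ≠ 0} :=
      isOpen_ne_fun (by fun_prop) (by fun_prop)
    filter_upwards [hopen.mem_nhds hz] with x hx
    have hxc : (x + algebraMap ℚ ℂ c) ^ d ≠ 0 := pow_ne_zero _ hx
    simp only [Function.comp_apply, hHP, hHQ, aeval_homSubst P d b c hP x hx,
      aeval_homSubst Q d b c hQ x hx]
    rw [mul_div_mul_left _ _ hxc]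
  have huniq := hf.unique (hg.congr_of_eventuallyEq hfg)
  -- conclude
  have hzc : algebraMap ℚ ℂ b * algebraMap ℚ ℂ c / (z + algebraMap ℚ ℂ c) ^ 2 ≠ 0 :=
    div_ne_zero hb'c' (pow_ne_zero _ hz)
  have hQy2 : (aeval y Q) ^ 2 ≠ 0 := pow_ne_zero _ hQy
  rw [map_sub, map_mul, map_mul]
  have := huniq.symm
  rw [mul_eq_zero, div_eq_zero_iff] at this
  rcases this with (h | h) | h
  · exact h
  · exact absurd h hQy2
  · exact absurd h hzc

end NoncriticalBelyi

end Literature.NumberTheory.DiophantineGeometry
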